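import Mathlib
import Summits.NavierStokesRegularity.NavierStokesRegularity.Theses.CertifiedBlowup

/-!
# NavierStokesRegularity — route `CertifiedBlowup`, support item `CertifiedBlowupRateDichotomy`

Settles `stmt-NavierStokesRegularity-8642`: the prove-or-kill dichotomy between crux #4
(`CertifiedBlowupVorticityRateExclusion`: every maximal finite-lifespan Leray–Hopf classical
solution from a rapidly decaying axisymmetric datum is super-Type-I in vorticity,
`∀ C, ∃ᶠ t → T⁻, ∃ x, C < (T - t) * ‖curl (u t) x‖`) and the negation of crux #3
(`CertifiedBlowupVorticityRateBlowup`: some such solution obeys `(T - t) * ‖curl (u t) x‖ ≤ C`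
eventually as `t ↑ T`). Pure logic: push `¬` through `∃` / `∧`, and
`∃ᶠ t, ∃ x, C < g t x ↔ ¬ ∀ᶠ t, ∀ x, g t x ≤ C` (`Filter.Frequently`, `not_exists`, `not_lt`).
No analysis is used; both cruxes stay open.
-/

-- single-conjunct summit: `Summit.<Summit>.<Problem>` repeats the name by convention (D-0017)
set_option linter.dupNamespace false

namespace Summit.NavierStokesRegularity.NavierStokesRegularity.Theorems

/-- Settles stmt-NavierStokesRegularity-8642 (`CertifiedBlowupRateDichotomy`, route `CertifiedBlowup`):
crux #4 (vorticity-rate exclusion, `∀ … ∀ C, ∃ᶠ t in 𝓝[<] T, ∃ x, C < (T - t) * ‖curl (u t) x‖`)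
is equivalent to the negation of crux #3 (the certificate class,
`∃ … ∃ C, ∀ᶠ t in 𝓝[<] T, ∀ x, (T - t) * ‖curl (u t) x‖ ≤ C`).
Proof: `Filter.Frequently p l` is by definition `¬ ∀ᶠ x in l, ¬ p x`; after `not_exists` / `not_and` /
`not_lt` both sides coincide syntactically. [folklore] -/
theorem certifiedBlowupRateDichotomy_proof :
    Summit.NavierStokesRegularity.NavierStokesRegularity.Theses.CertifiedBlowup.CertifiedBlowupRateDichotomy := by
  unfold Summit.NavierStokesRegularity.NavierStokesRegularity.Theses.CertifiedBlowup.CertifiedBlowupRateDichotomy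
  simp only [Filter.Frequently, not_exists, not_and, not_lt]

end Summit.NavierStokesRegularity.NavierStokesRegularity.Theorems
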